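import Literature.IUT.HodgeTheaters.StableCurveTemperedDataOfSpecialFibreTower
import Literature.IUT.HodgeTheaters.TemperedCoveringsCor23LevelsSub
import Literature.AnabelianGeometry.SemiGraphs.TemperedSpecialFibreTowerPiData
import Literature.AnabelianGeometry.SemiGraphs.SubgraphReachabilityTransport
import Literature.AnabelianGeometry.SemiGraphs.TemperedCompactInVerticialFinite
import HarnessLib

/-!
# [IUTchI] Cor. 2.3 at the levels of the Prop. 2.4 tower: the LEVEL SUBGRAPH DATA `SubgraphLevelData` at the
# genuine 𝔛-datum, from the special-fibre tower's `Π`-equivariant structure `PiData`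

Mochizuki, *Inter-universal Teichmüller theory I*, kurims manuscript (May 2020), §2: p. 45 l. 4–8 ("one may
think of `Π^tp_ℍ` … as the decomposition subgroup … associated to the sub-semi-graph `ℍ`"), Cor. 2.3 (vi) p. 48,
proof of Prop. 2.4 (i) p. 50 l. 27–30 ("the pro-`Σ` semi-graph of anabelioids `𝔾_J` associated to the special
fiber of the stable model … of the finite étale covering … determined by `J`", on which `Π^tp_X` acts through
`Π^tp_X/J`) ([IUTchI] §2 pp.45-50) [claim: Mochizuki2012, status: disputed] (D-0012 claim key; nothing of the
series is asserted here); consumed at [IUTchII] Cor. 2.4 (i) p. 71 l. 1 "[cf. also [CombGC], Proposition 1.2,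
(ii)]" (the connected components of the inverse image of `ℍ` are permuted).  Over Mochizuki, *Semi-graphs of
anabelioids*, Publ. RIMS **42** (2006), Ex. 3.10 pp. 44–45 and Lem. 1.8 p. 20 (group actions on semi-graphs)
[cite: MochizukiSemiAnbd2006, Ex 3.10 pp.44-45].

BRIDGE (abc-iut L3 → L5; seat abc-iut-w4-d063, the successor item of HANDOFF #2 of that lineage; GAP-LEDGER row
G-w4d063-1).  abc-iut-L5-t11's carrier extension `Prop24Tower.SubgraphLevelData` (`TemperedCoveringsCor23LevelsSub.lean`:
the vertices of `𝔾_{J_i}`, the action of `Π^tp_X` on them, the connected components of `p_i⁻¹(ℍ)`, the distinguished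
component `ℍ̃_i`, the cusp incidences) is CONSTRUCTED over the genuine level data
`towerOfSpecialFibreTower X d T …` (abc-iut-L5-t11, `StableCurveTemperedDataOfSpecialFibreTower.lean`) from the
special-fibre tower `T : SpecialFibreTower Δ^temp_X` and its `Π`-equivariant structure `P : SpecialFibreTower.PiData X d S T`
(abc-iut-L3-t2, `TemperedSpecialFibreTowerPiData.lean`):
* `Vtx i :=` the vertices of the level-`i` special fibre `𝔾^c_i = T.Gc i`;
* `act i :=` the DERIVED action `SpecialFibreTower.actVertex` of `Π^temp_{X_K}` on them (abc-iut-L3-t2,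
  `TemperedSpecialFibreTowerVertexAction.lean`: from (P0) + [SemiAnbd] Thm. 3.7 (ii), (iv)), its Thm. 3.7 (iv)
  binder `hiv` DISCHARGED by the finiteness of the fibres (`P.finite` + the tree's
  `maximalCompactIffVerticialAt_of_finiteGraph`; likewise abc-iut-L5-t11's `hCV` by `compactInVerticialAt_of_finiteGraph'`);
* `comps i :=` the connected components of `proj_i⁻¹(ℍ) ⊆ 𝔾^c_i` AS VERTEX SETS — DEFINED here (`compOf`) as the
  reachability classes, inside `P.preimageH i`, of the barycentric subdivision (the bare-semi-graph notion of
  abc-iut-w4-d076's `SubgraphReachabilityTransport.lean`);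
* `compH i :=` the class of the base lift `P.baseLift i` (the component `ℍ̃_i` over the base vertex of `ℍ`);
* `vtxCusp i x := P.vtxOfCusp i x`.
Over it the sub-DAG laws that ARE derivable become THEOREMS at the genuine datum: **B1 (a)** `LevelActsTrivially`
(`J_i = N_i` acts trivially: `actVertex_coe_eq_one` + the level identification `levelToN`), **B4** `CompsDisjoint`
(reachability classes) and `CompsInvariant` (the classes are permuted: `P.actGraph i g` is a semi-graph automorphism
whose vertex part IS `act i g` and which preserves `proj_i⁻¹(ℍ)` by equivariance `proj_actGraph` + `H_stable`;
`Subgraph.reachable_inl_aut_iff`), hence `IsBlock` (the consumer's `blkD`) — so the B4-L5 target `LevelTarget` holds at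
the genuine datum modulo base Cor. 2.3 (i), B3 `LevelIncidence` and B1 (c) `StabLeDeltaHLevel` only
(`levelTarget_ofSpecialFibre`).  NOT derivable from `PiData` and kept as named binders: B1 (b)(c) (they tie `compH i`
to the decomposition group `Π^tp_ℍ = TpH` of the datum — intended instantiation `TpH := P.TpH`), B2, B3.
RELATION to abc-iut-w4-d076's `CoveringLevelGraphs.toLevelData` (`TemperedCoveringsCor23LevelsGraph.lean`): that realisation
asks the `Π^tp_X`-action to be OVER `p_i` (`act_over`, deck transformations), which holds for `Δ^tp_X` but not for
`Π^tp_X` at the genuine datum (`G_k` moves `𝔾`, p. 47); here the EQUIVARIANT form `proj_actGraph` of `PiData` is used.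
Model-relative (∀ `X d S T P`); that a given curve carries such `T`, `P` is L3 origin data, not asserted; instantiated ≠
endorsed; nothing here bears on [IUTchIII] Cor. 3.12.  No instance, no notation, no new `Prop` fact.
-/

noncomputable section

namespace Literature.IUT.HodgeTheaters

open _root_.Topology CategoryTheory
open Literature.AnabelianGeometry.SemiGraphs Literature.AnabelianGeometry.SemiGraphs.ProfiniteSemiGraph

namespace StableCurveTemperedData

namespace OfSpecialFibre

/-! ### The connected components of `proj_i⁻¹(ℍ)` as vertex sets (bare semi-graph combinatorics) -/

section Components

variable {p : ℕ} [Fact p.Prime] {X : TemperedCurve p} {d : X.GroupLevelData}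
  {S : SpecialFibreData (X.toTemperedArithmeticGroup d)} {T : SpecialFibreTower X.DeltaTemp}
  (P : SpecialFibreTower.PiData X d S T)

/-- **The connected component of `proj_i⁻¹(ℍ) ⊆ 𝔾^c_i` through the vertex `v`, as a set of vertices**: the vertices
over `ℍ` joined to `v` by a walk of the barycentric subdivision of the sub-semi-graph `proj_i⁻¹(ℍ)` (empty when `v` is
not over `ℍ`) — "the connected components of the inverse image of `ℍ`" ([IUTchII] p. 71 l. 1, [CombGC] Prop. 1.2 (ii)).
([IUTchI] Cor 2.3(vi) p.48) [claim: Mochizuki2012, status: disputed] -/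
def compOf (i : ℕ) (v : (T.Gc i).graph.Vertex) : Set (T.Gc i).graph.Vertex :=
  {u | ∃ (hv : v ∈ (P.preimageH i).verts) (hu : u ∈ (P.preimageH i).verts),
    (P.preimageH i).toSemiGraph.subdivision.Reachable (Sum.inl ⟨v, hv⟩) (Sum.inl ⟨u, hu⟩)}

/-- Membership in `compOf`. [cite: MochizukiSemiAnbd2006, §1 p.12] -/
theorem mem_compOf_iff {i : ℕ} {v u : (T.Gc i).graph.Vertex} :
    u ∈ compOf P i v ↔ ∃ (hv : v ∈ (P.preimageH i).verts) (hu : u ∈ (P.preimageH i).verts),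
      (P.preimageH i).toSemiGraph.subdivision.Reachable (Sum.inl ⟨v, hv⟩) (Sum.inl ⟨u, hu⟩) :=
  Iff.rfl

/-- A component lies over `ℍ`. [cite: MochizukiSemiAnbd2006, §1 p.12] -/
theorem compOf_subset_preimageH (i : ℕ) (v : (T.Gc i).graph.Vertex) :
    compOf P i v ⊆ (P.preimageH i).verts := fun _ ⟨_, hu, _⟩ => hu

/-- A vertex over `ℍ` lies in its own component. [cite: MochizukiSemiAnbd2006, §1 p.12] -/
theorem mem_compOf_self {i : ℕ} {v : (T.Gc i).graph.Vertex} (hv : v ∈ (P.preimageH i).verts) :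
    v ∈ compOf P i v :=
  ⟨hv, hv, SimpleGraph.Reachable.refl _⟩

/-- The component of a vertex not over `ℍ` is empty. [cite: MochizukiSemiAnbd2006, §1 p.12] -/
theorem compOf_eq_empty {i : ℕ} {v : (T.Gc i).graph.Vertex} (hv : v ∉ (P.preimageH i).verts) :
    compOf P i v = ∅ :=
  Set.eq_empty_of_forall_notMem fun _ ⟨hv', _, _⟩ => hv hv'

/-- **Components meeting are equal** (reachability is an equivalence relation): if `u` lies in the components of `v`
and of `w`, these coincide. [cite: MochizukiSemiAnbd2006, §1 p.12] -/
theorem compOf_eq_of_mem {i : ℕ} {v w u : (T.Gc i).graph.Vertex} (h₁ : u ∈ compOf P i v)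
    (h₂ : u ∈ compOf P i w) : compOf P i v = compOf P i w := by
  obtain ⟨hv, hu, hvu⟩ := h₁
  obtain ⟨hw, hu', hwu⟩ := h₂
  have hvw : (P.preimageH i).toSemiGraph.subdivision.Reachable (Sum.inl ⟨v, hv⟩) (Sum.inl ⟨w, hw⟩) :=
    hvu.trans hwu.symm
  ext x
  constructor
  · rintro ⟨_, hx, h⟩
    exact ⟨hw, hx, hvw.symm.trans h⟩
  · rintro ⟨_, hx, h⟩
    exact ⟨hv, hx, hvw.trans h⟩

/-- **The connected components of `proj_i⁻¹(ℍ)`**, as a set of vertex sets: the components of the vertices over `ℍ`.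
([IUTchI] Cor 2.3(vi) p.48) [claim: Mochizuki2012, status: disputed] -/
def comps (i : ℕ) : Set (Set (T.Gc i).graph.Vertex) := compOf P i '' (P.preimageH i).verts

/-- Every vertex over `ℍ` lies in a member of `comps`, namely its own component. [cite: MochizukiSemiAnbd2006, §1 p.12] -/
theorem compOf_mem_comps {i : ℕ} {v : (T.Gc i).graph.Vertex} (hv : v ∈ (P.preimageH i).verts) :
    compOf P i v ∈ comps P i :=
  ⟨v, hv, rfl⟩

/-- **The vertices over `ℍ` are partitioned by `comps`**: each lies in exactly one member.
[cite: MochizukiSemiAnbd2006, §1 p.12] -/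
theorem existsUnique_mem_comps {i : ℕ} {v : (T.Gc i).graph.Vertex} (hv : v ∈ (P.preimageH i).verts) :
    ∃! A, A ∈ comps P i ∧ v ∈ A := by
  refine ⟨compOf P i v, ⟨compOf_mem_comps P hv, mem_compOf_self P hv⟩, ?_⟩
  rintro A ⟨⟨w, hw, rfl⟩, hvA⟩
  exact compOf_eq_of_mem P hvA (mem_compOf_self P hv)

/-- **The distinguished component `ℍ̃_i`**: the component of `proj_i⁻¹(ℍ)` through the base lift `P.baseLift i` (the
compatible lifts of the base vertex of `ℍ`; "the decomposition subgroup … associated to the sub-semi-graph `ℍ`",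
[IUTchI] p. 45 l. 4–8, singles out one component at every level). ([IUTchI] Prop 2.2 p.45) [claim: Mochizuki2012, status: disputed] -/
def compH (i : ℕ) : Set (T.Gc i).graph.Vertex := compOf P i (P.baseLift i)

/-- The base lift lies in `ℍ̃_i`. [cite: MochizukiSemiAnbd2006, Ex 3.10 p.44] -/
theorem baseLift_mem_compH (i : ℕ) : P.baseLift i ∈ compH P i :=
  mem_compOf_self P (P.baseLift_mem_preimageH i)

/-- `ℍ̃_i` is one of the components. [cite: MochizukiSemiAnbd2006, Ex 3.10 p.44] -/
theorem compH_mem_comps (i : ℕ) : compH P i ∈ comps P i :=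
  compOf_mem_comps P (P.baseLift_mem_preimageH i)

/-! ### The components are permuted by the action of `Π` on `𝔾^c_i` -/

/-- The semi-graph automorphism `P.actGraph i g` maps `proj_i⁻¹(ℍ)` into itself on vertices (equivariance of `proj i`
and `Π`-stability of `ℍ`; no Thm. 3.7 (iv) witness needed). [cite: MochizukiSemiAnbd2006, Lem. 1.8 p.20] -/
theorem actGraph_vertexMap_mem_preimageH (i : ℕ) (g : X.PiTemp) {v : (T.Gc i).graph.Vertex}
    (hv : v ∈ (P.preimageH i).verts) : (P.actGraph i g).hom.vertexMap v ∈ (P.preimageH i).verts := by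
  change (P.proj i).vertexMap ((P.actGraph i g).hom.vertexMap v) ∈ P.H.verts
  have h := congrArg (fun F => SemiGraph.Hom.vertexMap F v) (P.proj_actGraph i g)
  change (P.proj i).vertexMap ((P.actGraph i g).hom.vertexMap v) =
    (P.actGraph₀ g).hom.vertexMap ((P.proj i).vertexMap v) at h
  rw [h]
  exact (P.H_stable g).1 _ hv

/-- The inverse automorphism `(P.actGraph i g).inv = (P.actGraph i g⁻¹).hom` also preserves `proj_i⁻¹(ℍ)` (vertices).
[cite: MochizukiSemiAnbd2006, Lem. 1.8 p.20] -/
theorem actGraph_inv_vertexMap_mem_preimageH (i : ℕ) (g : X.PiTemp) {v : (T.Gc i).graph.Vertex}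
    (hv : v ∈ (P.preimageH i).verts) : (P.actGraph i g).inv.vertexMap v ∈ (P.preimageH i).verts := by
  have h := actGraph_vertexMap_mem_preimageH P i g⁻¹ hv
  rwa [map_inv] at h

/-- The inverse automorphism also preserves `proj_i⁻¹(ℍ)` (edges). [cite: MochizukiSemiAnbd2006, Lem. 1.8 p.20] -/
theorem actGraph_inv_edgeMap_mem_preimageH (i : ℕ) (g : X.PiTemp) {e : (T.Gc i).graph.Edge}
    (he : e ∈ (P.preimageH i).edges) : (P.actGraph i g).inv.edgeMap e ∈ (P.preimageH i).edges := by
  have h := P.actGraph_edge_mem_preimageH i g⁻¹ he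
  rwa [map_inv] at h

/-- **Reachability inside `proj_i⁻¹(ℍ)` is invariant under the `Π`-action** (`Subgraph.reachable_inl_aut_iff` for the
automorphism `P.actGraph i g`, which preserves `proj_i⁻¹(ℍ)` together with its inverse).
[cite: MochizukiSemiAnbd2006, Lem. 1.8 p.20] -/
theorem reachable_actGraph_iff (i : ℕ) (g : X.PiTemp) {v w : (T.Gc i).graph.Vertex}
    (hv : v ∈ (P.preimageH i).verts) (hw : w ∈ (P.preimageH i).verts) :
    (P.preimageH i).toSemiGraph.subdivision.Reachable
        (Sum.inl ⟨(P.actGraph i g).hom.vertexMap v, actGraph_vertexMap_mem_preimageH P i g hv⟩)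
        (Sum.inl ⟨(P.actGraph i g).hom.vertexMap w, actGraph_vertexMap_mem_preimageH P i g hw⟩) ↔
      (P.preimageH i).toSemiGraph.subdivision.Reachable (Sum.inl ⟨v, hv⟩) (Sum.inl ⟨w, hw⟩) :=
  SemiGraph.Subgraph.reachable_inl_aut_iff (P.preimageH i) (P.actGraph i g)
    (fun _ hu => actGraph_vertexMap_mem_preimageH P i g hu) (fun _ he => P.actGraph_edge_mem_preimageH i g he)
    (fun _ hu => actGraph_inv_vertexMap_mem_preimageH P i g hu)
    (fun _ he => actGraph_inv_edgeMap_mem_preimageH P i g he) hv hw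

/-- **The image of a component under `g ∈ Π` is the component of the image vertex.**
[cite: MochizukiSemiAnbd2006, Lem. 1.8 p.20] -/
theorem image_compOf (i : ℕ) (g : X.PiTemp) (v : (T.Gc i).graph.Vertex) :
    (fun u => (P.actGraph i g).hom.vertexMap u) '' compOf P i v = compOf P i ((P.actGraph i g).hom.vertexMap v) := by
  by_cases hv : v ∈ (P.preimageH i).verts
  · ext u
    constructor
    · rintro ⟨u₀, ⟨_, hu₀, hr⟩, rfl⟩
      exact ⟨actGraph_vertexMap_mem_preimageH P i g hv, actGraph_vertexMap_mem_preimageH P i g hu₀,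
        (reachable_actGraph_iff P i g hv hu₀).2 hr⟩
    · rintro ⟨_, hu, hr⟩
      have hu' : (P.actGraph i g).inv.vertexMap u ∈ (P.preimageH i).verts :=
        actGraph_inv_vertexMap_mem_preimageH P i g hu
      have e1 : (P.actGraph i g).hom.vertexMap ((P.actGraph i g).inv.vertexMap u) = u :=
        SemiGraph.inv_vertexMap_hom_vertexMap (P.actGraph i g).symm u
      refine ⟨(P.actGraph i g).inv.vertexMap u, ⟨hv, hu', ?_⟩, e1⟩
      apply (reachable_actGraph_iff P i g hv hu').1
      have e2 : (⟨(P.actGraph i g).hom.vertexMap ((P.actGraph i g).inv.vertexMap u),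
          actGraph_vertexMap_mem_preimageH P i g hu'⟩ : (P.preimageH i).toSemiGraph.Vertex) = ⟨u, hu⟩ :=
        Subtype.ext e1
      rw [e2]
      exact hr
  · have hv' : (P.actGraph i g).hom.vertexMap v ∉ (P.preimageH i).verts := by
      intro h
      apply hv
      have h' := actGraph_inv_vertexMap_mem_preimageH P i g h
      rwa [SemiGraph.inv_vertexMap_hom_vertexMap] at h'
    rw [compOf_eq_empty P hv, compOf_eq_empty P hv', Set.image_empty]

/-- **`Π` permutes the components of `proj_i⁻¹(ℍ)`** ([IUTchII] p. 71 l. 1 "[cf. also [CombGC], Proposition 1.2,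
(ii)]"). [cite: MochizukiSemiAnbd2006, Lem. 1.8 p.20] -/
theorem image_mem_comps (i : ℕ) (g : X.PiTemp) {A : Set (T.Gc i).graph.Vertex} (hA : A ∈ comps P i) :
    (fun u => (P.actGraph i g).hom.vertexMap u) '' A ∈ comps P i := by
  obtain ⟨v, hv, rfl⟩ := hA
  rw [image_compOf]
  exact compOf_mem_comps P (actGraph_vertexMap_mem_preimageH P i g hv)

/-- **Thm. 3.7 (iii) at every fibre `𝒢^c_i`, DISCHARGED by finiteness** (`P.finite`: the dual semi-graphs of the
special fibres are finite; `compactInVerticialAt_of_finiteGraph'`, the tree's finite-graph theorem) — abc-iut-L5-t11's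
binder `hCV` of `prop24i_ofSpecialFibre_byName` at the genuine datum. [cite: MochizukiSemiAnbd2006, Thm 3.7(iii) pp.40-41] -/
theorem compactInVerticialAt_of_piData (P : SpecialFibreTower.PiData X d S T) (i : ℕ) :
    CompactInVerticialAt (T.Gc i) :=
  compactInVerticialAt_of_finiteGraph' (P.finite.finite_vertex i) (P.finite.finite_edge i)

/-- **Thm. 3.7 (iv) at every fibre `𝒢^c_i`, DISCHARGED by finiteness** (`maximalCompactIffVerticialAt_of_finiteGraph`)
— the binder `hiv` of abc-iut-L3-t2's `actVertex` at the genuine datum. [cite: MochizukiSemiAnbd2006, Thm 3.7(iv) p.41] -/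
theorem maximalCompactIffVerticialAt_of_piData (P : SpecialFibreTower.PiData X d S T) (i : ℕ) :
    MaximalCompactIffVerticialAt (T.Gc i) := by
  haveI := P.finite.finite_vertex i
  haveI := P.finite.finite_edge i
  exact maximalCompactIffVerticialAt_of_finiteGraph

end Components

/-! ### The level subgraph data at the genuine 𝔛-datum -/

section LevelData

variable {p : ℕ} [Fact p.Prime] (X : TemperedCurve p) (d : X.GroupLevelData)
  (T : SpecialFibreTower X.DeltaTemp)
  (Sigma SigmaHat : Set ℕ) (hsub : Sigma ⊆ SigmaHat) (hne : Sigma.Nonempty)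
  (hprime : ∀ q ∈ SigmaHat, q.Prime)
  (S : SpecialFibreData (X.toTemperedArithmeticGroup d)) (h36 : S.Gc.Prop36Hypotheses)
  (hp : p ∉ Sigma) (TpH : Subgroup S.chart.G)
  (HatH : Subgroup (TemperedGraphGroupData.exists_completion_of_prop36 S.Gc h36 S.chart).choose)
  (hle : TpH.map (TemperedGraphGroupData.exists_completion_of_prop36 S.Gc h36
    S.chart).choose_spec.choose.toMonoidHom ≤ HatH)
  (cuspMeetsH : {x : X.Pt // X.IsCusp x} → Prop)
  (P : SpecialFibreTower.PiData X d S T)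

/-- **The LEVEL SUBGRAPH DATA `SubgraphLevelData` at the genuine 𝔛-datum** over the level data
`towerOfSpecialFibreTower` (levels `Ĵ_i =` closure of `ι(N_i)`, graphs `𝔾_{J_i} = 𝔾^c_i`): vertices of `𝔾^c_i`, the
DERIVED vertex action `actVertex` (its Thm. 3.7 (iv) input discharged by finiteness), the connected components of `proj_i⁻¹(ℍ)` and the
distinguished one `ℍ̃_i` through the base lift, the cusp incidences `vtxOfCusp` — all from the `Π`-equivariant structure
`P : PiData` of the special-fibre tower (intended instantiation of the datum's `Π^tp_ℍ`: `TpH := P.TpH`).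
([IUTchI] Prop 2.4(i) p.50) [claim: Mochizuki2012, status: disputed] -/
def levelDataOfSpecialFibreTower :
    (towerOfSpecialFibreTower X d T Sigma SigmaHat hsub hne hprime S h36 hp TpH HatH hle
      cuspMeetsH).SubgraphLevelData where
  Vtx i := (T.Gc i).graph.Vertex
  act i := T.actVertex (hΔ := X.normal_deltaTemp) P.admKer_normal_pi i (maximalCompactIffVerticialAt_of_piData P i)
  comps i := comps P i
  compH i := compH P i
  compH_mem i := compH_mem_comps P i
  vtxCusp i x := P.vtxOfCusp i x

/-- The action of the level data IS the derived vertex action `actVertex`. ([IUTchI] Prop 2.4(i) p.50) [claim: Mochizuki2012, status: disputed] -/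
theorem levelDataOfSpecialFibreTower_act_apply (i : ℕ) (g : X.PiTemp) (v : (T.Gc i).graph.Vertex) :
    (levelDataOfSpecialFibreTower X d T Sigma SigmaHat hsub hne hprime S h36 hp TpH HatH hle cuspMeetsH P).act
        i g v = T.actVertex (hΔ := X.normal_deltaTemp) P.admKer_normal_pi i (maximalCompactIffVerticialAt_of_piData P i) g v :=
  rfl

/-- The action of the level data is the VERTEX PART of the semi-graph action `P.actGraph` (law `actGraph_vertexMap`).
([IUTchI] Prop 2.4(i) p.50) [claim: Mochizuki2012, status: disputed] -/
theorem levelDataOfSpecialFibreTower_act_eq_actGraph (i : ℕ) (g : X.PiTemp) (v : (T.Gc i).graph.Vertex) :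
    (levelDataOfSpecialFibreTower X d T Sigma SigmaHat hsub hne hprime S h36 hp TpH HatH hle cuspMeetsH P).act
        i g v = (P.actGraph i g).hom.vertexMap v :=
  (P.actGraph_vertexMap i (maximalCompactIffVerticialAt_of_piData P i) g v).symm

/-- **B1 (a) `LevelActsTrivially` PROVED at the genuine datum**: the level `J_i = Δ^tp_X ∩ ι⁻¹(Ĵ_i)` IS `N_i`
(`levelToN`, from "`Ĵ ∩ Δ^tp_X = J`"), and `N_i` acts trivially on the vertices of `𝔾^c_i` (`actVertex_coe_eq_one`:
inner automorphisms fix every verticial conjugacy class). [cite: Mochizuki2012, Prop 2.4(i) p.50] -/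
theorem levelDataOfSpecialFibreTower_levelActsTrivially :
    (levelDataOfSpecialFibreTower X d T Sigma SigmaHat hsub hne hprime S h36 hp TpH HatH hle cuspMeetsH P).LevelActsTrivially := by
  intro i j hj
  exact T.actVertex_coe_eq_one (hΔ := X.normal_deltaTemp) P.admKer_normal_pi i (maximalCompactIffVerticialAt_of_piData P i)
    (levelToN X d T Sigma SigmaHat hsub hne hprime S h36 hp TpH HatH hle cuspMeetsH i ⟨j, hj⟩)

/-- **B4 (i) `CompsDisjoint` PROVED at the genuine datum**: distinct components of `proj_i⁻¹(ℍ)` are disjoint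
(reachability classes). [cite: Mochizuki2012, Cor 2.3(vi) p.48] -/
theorem levelDataOfSpecialFibreTower_compsDisjoint :
    (levelDataOfSpecialFibreTower X d T Sigma SigmaHat hsub hne hprime S h36 hp TpH HatH hle cuspMeetsH P).CompsDisjoint := by
  rintro i A ⟨v, hv, rfl⟩ B ⟨w, hw, rfl⟩ ⟨u, huA, huB⟩
  exact compOf_eq_of_mem P huA huB

/-- **B4 (ii) `CompsInvariant` PROVED at the genuine datum**: `Π^temp_{X_K}` permutes the components of `proj_i⁻¹(ℍ)`
(the vertex action is the vertex part of the semi-graph automorphisms `P.actGraph i g`, which preserve `proj_i⁻¹(ℍ)`).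
[cite: Mochizuki2012, Cor 2.3 p.47] -/
theorem levelDataOfSpecialFibreTower_compsInvariant :
    (levelDataOfSpecialFibreTower X d T Sigma SigmaHat hsub hne hprime S h36 hp TpH HatH hle cuspMeetsH P).CompsInvariant := by
  intro i t A hA
  have h : ((levelDataOfSpecialFibreTower X d T Sigma SigmaHat hsub hne hprime S h36 hp TpH HatH hle cuspMeetsH P).act i t : (T.Gc i).graph.Vertex → (T.Gc i).graph.Vertex) '' A =
        (fun u => (P.actGraph i t).hom.vertexMap u) '' A :=
    Set.image_congr fun u _ =>
      levelDataOfSpecialFibreTower_act_eq_actGraph X d T Sigma SigmaHat hsub hne hprime S h36 hp TpH HatH hle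
        cuspMeetsH P i t u
  change ((levelDataOfSpecialFibreTower X d T Sigma SigmaHat hsub hne hprime S h36 hp TpH HatH hle cuspMeetsH P).act i t : (T.Gc i).graph.Vertex → (T.Gc i).graph.Vertex) '' A ∈ comps P i
  rw [h]
  exact image_mem_comps P i t hA

/-- **`IsBlock` (the consumer's `blkD`) at the genuine datum**: an element moving one vertex of `ℍ̃_i` into `ℍ̃_i`
stabilises `ℍ̃_i` (from B4 (i)+(ii), `isBlock_of_comps`). [cite: Mochizuki2012, Cor 2.3(vi) p.48] -/
theorem levelDataOfSpecialFibreTower_isBlock :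
    (levelDataOfSpecialFibreTower X d T Sigma SigmaHat hsub hne hprime S h36 hp TpH HatH hle cuspMeetsH P).IsBlock :=
  (levelDataOfSpecialFibreTower X d T Sigma SigmaHat hsub hne hprime S h36 hp TpH HatH hle cuspMeetsH P).isBlock_of_comps
    (levelDataOfSpecialFibreTower_compsDisjoint X d T Sigma SigmaHat hsub hne hprime S h36 hp TpH HatH hle cuspMeetsH
      P)
    (levelDataOfSpecialFibreTower_compsInvariant X d T Sigma SigmaHat hsub hne hprime S h36 hp TpH HatH hle
      cuspMeetsH P)

/-- **B1 as an equivalence at the genuine datum, modulo B1 (b)(c)**: for `γ ∈ Δ^tp_X`, `γ` stabilises `ℍ̃_i` iff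
`γ ∈ Δ^tp_{X,ℍ} · J_i` — B1 (a) is discharged (`stabilizes_iff`). [cite: Mochizuki2012, Prop 2.2 p.45] -/
theorem stabilizes_iff_ofSpecialFibre
    (hH : (levelDataOfSpecialFibreTower X d T Sigma SigmaHat hsub hne hprime S h36 hp TpH HatH hle cuspMeetsH P).DeltaHStabilizes)
    (hstab : (levelDataOfSpecialFibreTower X d T Sigma SigmaHat hsub hne hprime S h36 hp TpH HatH hle cuspMeetsH P).StabLeDeltaHLevel)
    (i : ℕ)
    (γ : (ofSpecialFibre X d S h36 Sigma SigmaHat hsub hne hprime hp TpH HatH hle cuspMeetsH).DeltaTp) :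
    (∀ v ∈ compH P i, T.actVertex (hΔ := X.normal_deltaTemp) P.admKer_normal_pi i (maximalCompactIffVerticialAt_of_piData P i)
        (γ : X.PiTemp) v ∈ compH P i) ↔
      ∃ k ∈ (ofSpecialFibre X d S h36 Sigma SigmaHat hsub hne hprime hp TpH HatH hle cuspMeetsH).deltaTpH,
        k⁻¹ * γ ∈ (ofSpecialFibre X d S h36 Sigma SigmaHat hsub hne hprime hp TpH HatH hle cuspMeetsH).levelTp
          (levelJhat X T i) :=
  (levelDataOfSpecialFibreTower X d T Sigma SigmaHat hsub hne hprime S h36 hp TpH HatH hle cuspMeetsH P).stabilizes_iff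
    (levelDataOfSpecialFibreTower_levelActsTrivially X d T Sigma SigmaHat hsub hne hprime S h36 hp TpH HatH hle
      cuspMeetsH P) hH hstab i γ

/-- **The B4-L5 target `LevelTarget` at the genuine datum, modulo base Cor. 2.3 (i), B3 and B1 (c) ONLY** — the block
property is discharged (`levelTarget_of_inputs` with `IsBlock` proved). [cite: Mochizuki2012, Cor 2.3(vi) p.48] -/
theorem levelTarget_ofSpecialFibre
    (h23i : (ofSpecialFibre X d S h36 Sigma SigmaHat hsub hne hprime hp TpH HatH hle cuspMeetsH).Cor23i)
    (hinc : (levelDataOfSpecialFibreTower X d T Sigma SigmaHat hsub hne hprime S h36 hp TpH HatH hle cuspMeetsH P).LevelIncidence)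
    (hstab : (levelDataOfSpecialFibreTower X d T Sigma SigmaHat hsub hne hprime S h36 hp TpH HatH hle cuspMeetsH P).StabLeDeltaHLevel) :
    (towerOfSpecialFibreTower X d T Sigma SigmaHat hsub hne hprime S h36 hp TpH HatH hle cuspMeetsH).LevelTarget :=
  (levelDataOfSpecialFibreTower X d T Sigma SigmaHat hsub hne hprime S h36 hp TpH HatH hle cuspMeetsH P).levelTarget_of_inputs h23i hinc
    (levelDataOfSpecialFibreTower_isBlock X d T Sigma SigmaHat hsub hne hprime S h36 hp TpH HatH hle cuspMeetsH P)
    hstab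

include d in
/-- **The levels shrink to `1`** (the [IUTchII] Cor. 2.4 (i) consumer's `hbasis'`; [IUTchI] p. 50 l. 40 "by allowing
`J` to vary"): under the cofinality reading `hcof` of the `N_i`, every neighbourhood of `1` in the profinite `Π_{X_K}`
contains some level `Ĵ_i` (an open normal subgroup inside the neighbourhood, abc-iut-L5-t11's `levelJhat_cofinal_aux` on
its trace in `Δ_X`, and `Ĵ_i ⊆ Δ_X`). [cite: Mochizuki2012, Prop 2.4(i) p.50] -/
theorem levels_hbasis_ofSpecialFibre
    (hcof : ∀ U : Subgroup X.DeltaTemp, IsOpen (U : Set X.DeltaTemp) → U.Normal → U.FiniteIndex →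
      ∃ i, T.N i ≤ U) :
    ∀ O ∈ 𝓝 (1 : X.PiHat), ∃ i, ((levelJhat X T i : Subgroup X.PiHat) : Set X.PiHat) ⊆ O := by
  intro O hO
  haveI : CompactSpace X.PiHat := X.isProfiniteCompletion_toHat.compactSpace
  haveI : T2Space X.PiHat := X.isProfiniteCompletion_toHat.t2Space
  haveI : TotallyDisconnectedSpace X.PiHat := X.isProfiniteCompletion_toHat.totallyDisconnectedSpace
  obtain ⟨V, hVO, hVopen, hV1⟩ := mem_nhds_iff.mp hO
  obtain ⟨W, hW⟩ := ProfiniteGrp.exist_openNormalSubgroup_sub_open_nhds_of_one hVopen hV1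
  obtain ⟨i, hi⟩ := levelJhat_cofinal_aux X d T hcof X.DeltaHat rfl (W.toSubgroup.comap X.DeltaHat.subtype)
    (W.isOpen'.preimage continuous_subtype_val)
  refine ⟨i, fun z hz => hVO (hW ?_)⟩
  have hzΔ : z ∈ X.DeltaHat := levelJhat_le_deltaHat X T i hz
  have h1 : (⟨z, hzΔ⟩ : X.DeltaHat) ∈ (levelJhat X T i).subgroupOf X.DeltaHat := hz
  exact hi h1

include d P in
/-- **The levels shrink to `1` at the genuine datum WITH its `Π`-equivariant structure**: `hcof` is the record's
field `N_cofinal`. [cite: Mochizuki2012, Prop 2.4(i) p.50] -/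
theorem levels_hbasis_ofPiData :
    ∀ O ∈ 𝓝 (1 : X.PiHat), ∃ i, ((levelJhat X T i : Subgroup X.PiHat) : Set X.PiHat) ⊆ O :=
  levels_hbasis_ofSpecialFibre X d T P.N_cofinal

/-- **Non-vacuity of the carrier extension at the genuine datum**: `SubgraphLevelData` over `towerOfSpecialFibreTower`
is inhabited by the construction (given the origin data `P`).
([IUTchI] Prop 2.4(i) p.50) [claim: Mochizuki2012, status: disputed] -/
theorem nonempty_subgraphLevelData_ofSpecialFibre (P : SpecialFibreTower.PiData X d S T) :
    Nonempty (towerOfSpecialFibreTower X d T Sigma SigmaHat hsub hne hprime S h36 hp TpH HatH hle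
      cuspMeetsH).SubgraphLevelData :=
  ⟨levelDataOfSpecialFibreTower X d T Sigma SigmaHat hsub hne hprime S h36 hp TpH HatH hle cuspMeetsH P⟩

end LevelData

end OfSpecialFibre

end StableCurveTemperedData

end Literature.IUT.HodgeTheaters

end
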